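import Literature.MathematicalPhysics.QuantumFieldTheory.Balaban1983to89.B9B8KnitNeumannCore

/-!
# `Balaban1983to89.B9B8KnitNeumannCoreReal` — file 7b: the Neumann core of file 7a OVER A GENERAL SCALAR FIELD, and the three-members lemma for a
# REAL-LINEAR perturbation `E` of def-Y's `Δ_a(U)` (the knit's letters — dag-n06's `entryT`-transpose and the orthogonal projection `projRPer` for the
# real pairing `Re τ(x*y)` — are ℝ-linear, not ℂ-linear)

statement-level skeleton of published theorems with citation tags; proofs where landed; nothing here is a claim about the
Yang–Mills mass gap

Sub-row G-B8-T2S (unit `lit-balaban-t2s-1`, gen 6), RULING #10 road (d).  File 7a (`B9B8KnitNeumannCore`) proved the fixed-point core for `ℂ`-linear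
`T, G, E`; the perturbation of the junction, `E♭ = Δ_a(U) − (c_fη)²·(Δ_knit)♭`, is only `ℝ`-LINEAR (dag-n06's `QQZdP` is built with the real-basis transpose
`entryT`, its `DRDs` with the `formPer`-orthogonal projection).  THIS FILE proves the three-members lemma with `T := (deltaAY …).restrictScalars ℝ`, `G := (GAY …).restrictScalars ℝ`, `E : Module.End ℝ`, the
fixed-point core of file 7a §1 INLINED over `ℝ` (the gate's dedup forbids re-landing the core lemmas at another scalar field).  Same citations and scope as
file 7a: [4] Thm 3.3 p. 399, (3.47) p. 398, (3.26)–(3.27) p. 395; [B8] (1.58)–(1.59) p. 86; OUR READING: the smallness `2εB₀ ≤ 1` is the junction's.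

WHAT IS PROVED (kernel, 0 sorry, one theorem): ★★★ `GAY_sub_three_members_real`.

HONEST SCOPE.  Linear algebra; `E` abstract; the three `hG` hypotheses displayed; count-neutral; the Yang–Mills mass gap is NOT proved by any of this.
No `sorry`, no `def`, no `… : Prop` fact, no `instance`, no `notation`.  NEW file; file 7a's §2 (`wNormBY_eq_weight_mul_norm`) by name.
-/

noncomputable section

namespace Literature.MathematicalPhysics.QuantumFieldTheory.Balaban1983to89.B9B8KnitNeumannCoreReal

open scoped BigOperators
open Node00
open B6KLevelCensusIndexV1 (KIdx)
open B6GlobalChartV1 (PV blkV1)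
open B8ScaledSupNorm (weight)
open B8Ineq159AtLettersY (wNormBY_nonneg wNormBY_le_of_weight_mul_norm_le)
open B9B8KnitNormsTransfer (weight_level_pos)
open B9B8KnitNeumannCore (wNormBY_eq_weight_mul_norm)

/-! ## The three members of [4] Thm 3.3 ∕ [B8] (1.59) pass from `G(U) = Δ_a(U)⁻¹` to `(Δ_a(U) − E)⁻¹` -/

section Members

variable {d ℓ : ℕ} {hd : 1 ≤ d + 1} {hL : Odd (ℓ + 1) ∧ 1 < ℓ + 1} {b₀ b₁ : ℝ}
variable {𝔸 : Type} [NormedRing 𝔸] [NormedAlgebra ℂ 𝔸] [CompleteSpace 𝔸] [FiniteDimensional ℝ 𝔸]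
variable (i : KIdx d ℓ hd hL b₀ b₁) {n : ℕ}

/-- ★★★ **THE NEUMANN JUNCTION AT def-Y's LETTERS, REAL-LINEAR PERTURBATION.**  At a constant-level member, let `Δ_a(U) = deltaAY i parS parB Gp U` be invertible with
`G(U) = GAY i parS parB Gp U` satisfying the three (3.47)_{γ=−3} members of B-LINE 2 at constant `B₀` (`|GF|₍₋₁₎`, `|∇_νGF|₍₋₂₎`, `|Δ GF|₍₋₃₎ ≤ B₀|F|₍₋₃₎`),
and let `E` be a bond operator with `|EA|₍₋₃₎ ≤ ε|A|₍₋₁₎`, `0 ≤ ε`, `2εB₀ ≤ 1`.  Then `Δ_a(U) − E` is invertible and its inverse satisfies the same three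
members at constant `2B₀`.  (OUR READING: the smallness `2εB₀ ≤ 1` is the junction's.)
[cite: Balaban1985BackgroundPropagators, Thm 3.3 p.399, (3.47) p.398, (3.26)–(3.27) p.395; Balaban1985RegularSpaces, (1.58)–(1.59) p.86] -/
theorem GAY_sub_three_members_real (hlev : ∀ z : SiteY i, levY i z = n) (parS : SiteParY 𝔸 i) (parB : BondParY 𝔸 i) (Gp : SiteOpY 𝔸 i)
    (U : CfgY 𝔸 i) (hΔ : IsUnit (deltaAY i parS parB Gp U)) {B₀ ε : ℝ} (hB₀ : 0 ≤ B₀) (hε : 0 ≤ ε) (hεB : 2 * ε * B₀ ≤ 1)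
    (hG0 : ∀ F, wNormBY i (-1) (GAY i parS parB Gp U F) ≤ B₀ * wNormBY i (-3) F)
    (hG1 : ∀ F ν, wNormBY i (-2) (cdB i U ν (GAY i parS parB Gp U F)) ≤ B₀ * wNormBY i (-3) F)
    (hG3 : ∀ F, wNormBY i (-3) (lapB i U (GAY i parS parB Gp U F)) ≤ B₀ * wNormBY i (-3) F)
    (E : Module.End ℝ (FBondY i → 𝔸)) (hE : ∀ A, wNormBY i (-3) (E A) ≤ ε * wNormBY i (-1) A) :
    IsUnit ((deltaAY i parS parB Gp U).restrictScalars ℝ - E) ∧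
      (∀ F, wNormBY i (-1) (Ring.inverse ((deltaAY i parS parB Gp U).restrictScalars ℝ - E) F) ≤ 2 * B₀ * wNormBY i (-3) F) ∧
      (∀ F ν, wNormBY i (-2) (cdB i U ν (Ring.inverse ((deltaAY i parS parB Gp U).restrictScalars ℝ - E) F)) ≤ 2 * B₀ * wNormBY i (-3) F) ∧
      (∀ F, wNormBY i (-3) (lapB i U (Ring.inverse ((deltaAY i parS parB Gp U).restrictScalars ℝ - E) F)) ≤ 2 * B₀ * wNormBY i (-3) F) := by
  -- the weights
  set w₁ := weight (ℓ + 1) |i.cf|⁻¹ (-1) n with hw₁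
  set w₂ := weight (ℓ + 1) |i.cf|⁻¹ (-2) n with hw₂
  set w₃ := weight (ℓ + 1) |i.cf|⁻¹ (-3) n with hw₃
  have hw₁p : 0 < w₁ := weight_level_pos i _ n
  have hw₂p : 0 < w₂ := weight_level_pos i _ n
  have hw₃p : 0 < w₃ := weight_level_pos i _ n
  have hN : ∀ (α : ℝ) (Ψ : FBondY i → 𝔸), wNormBY i α Ψ = weight (ℓ + 1) |i.cf|⁻¹ α n * ‖Ψ‖ := fun α Ψ => wNormBY_eq_weight_mul_norm i hlev α Ψ
  -- the hypotheses in sup-norm currency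
  set T : Module.End ℝ (FBondY i → 𝔸) := (deltaAY i parS parB Gp U).restrictScalars ℝ with hT
  set G : Module.End ℝ (FBondY i → 𝔸) := (GAY i parS parB Gp U).restrictScalars ℝ with hG
  have hGT : ∀ v, G (T v) = v := fun v => by
    have h := congrArg (fun S : Module.End ℂ (FBondY i → 𝔸) => S v) (Ring.inverse_mul_cancel _ hΔ)
    simp only [Module.End.mul_apply, Module.End.one_apply] at h
    exact h
  have hGsup : ∀ v, ‖G v‖ ≤ (B₀ * w₃ / w₁) * ‖v‖ := fun v => by
    have h := hG0 v
    rw [hN, hN] at h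
    have h' : w₁ * ‖G v‖ ≤ B₀ * (w₃ * ‖v‖) := h
    rw [div_mul_eq_mul_div, le_div_iff₀ hw₁p]
    calc ‖G v‖ * w₁ = w₁ * ‖G v‖ := mul_comm _ _
      _ ≤ B₀ * (w₃ * ‖v‖) := h'
      _ = B₀ * w₃ * ‖v‖ := by ring
  have hEsup : ∀ v, ‖E v‖ ≤ (ε * w₁ / w₃) * ‖v‖ := fun v => by
    have h := hE v
    rw [hN, hN] at h
    have : w₃ * ‖E v‖ ≤ ε * (w₁ * ‖v‖) := h
    rw [div_mul_eq_mul_div, le_div_iff₀ hw₃p]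
    calc ‖E v‖ * w₃ = w₃ * ‖E v‖ := mul_comm _ _
      _ ≤ ε * (w₁ * ‖v‖) := this
      _ = ε * w₁ * ‖v‖ := by ring
  have hβ : 0 ≤ B₀ * w₃ / w₁ := by positivity
  have hε' : 0 ≤ ε * w₁ / w₃ := by positivity
  have hεβ : (ε * w₁ / w₃) * (B₀ * w₃ / w₁) ≤ 1 / 2 := by
    have : (ε * w₁ / w₃) * (B₀ * w₃ / w₁) = ε * B₀ := by field_simp
    rw [this]
    linarith
  -- the fixed-point core of file 7a §1, over `ℝ`
  set β := B₀ * w₃ / w₁ with hβdef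
  set ε' := ε * w₁ / w₃ with hε'def
  have hU : IsUnit (T - E) := by
    refine (LinearMap.isUnit_iff_ker_eq_bot _).2 ((LinearMap.ker_eq_bot'.2) fun v hv => ?_)
    have hTE : T v = E v := sub_eq_zero.1 (by simpa [LinearMap.sub_apply] using hv)
    have hfix : v = G (E v) := by rw [← hTE, hGT]
    have h1 : ‖v‖ ≤ β * (ε' * ‖v‖) := by
      calc ‖v‖ = ‖G (E v)‖ := by rw [← hfix]
        _ ≤ β * ‖E v‖ := hGsup _
        _ ≤ β * (ε' * ‖v‖) := mul_le_mul_of_nonneg_left (hEsup v) hβ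
    have h2 : β * (ε' * ‖v‖) = (ε' * β) * ‖v‖ := by ring
    have h3 : (ε' * β) * ‖v‖ ≤ (1 / 2) * ‖v‖ := mul_le_mul_of_nonneg_right hεβ (norm_nonneg _)
    have h4 : ‖v‖ = 0 := by
      have := norm_nonneg v
      linarith
    exact norm_eq_zero.1 h4
  have hfp : ∀ v, Ring.inverse (T - E) v = G (v + E (Ring.inverse (T - E) v)) := fun v => by
    set w := Ring.inverse (T - E) v with hw
    have hsol : (T - E) w = v := by
      have h := congrArg (fun S : Module.End ℝ (FBondY i → 𝔸) => S v) (Ring.mul_inverse_cancel _ hU)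
      simpa only [Module.End.mul_apply, Module.End.one_apply] using h
    have hT' : T w = v + E w := by
      rw [LinearMap.sub_apply] at hsol
      rw [← hsol, sub_add_cancel]
    rw [← hT', hGT]
  have hn0 : ∀ v, ‖Ring.inverse (T - E) v‖ ≤ 2 * β * ‖v‖ := fun v => by
    set w := Ring.inverse (T - E) v with hw
    have h1 : ‖w‖ ≤ β * ‖v‖ + (ε' * β) * ‖w‖ := by
      calc ‖w‖ = ‖G (v + E w)‖ := by rw [hw, ← hfp v]
        _ ≤ β * ‖v + E w‖ := hGsup _
        _ ≤ β * (‖v‖ + ‖E w‖) := mul_le_mul_of_nonneg_left (norm_add_le _ _) hβ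
        _ ≤ β * (‖v‖ + ε' * ‖w‖) := mul_le_mul_of_nonneg_left (add_le_add_right (hEsup w) _) hβ
        _ = β * ‖v‖ + (ε' * β) * ‖w‖ := by ring
    have h2 : (ε' * β) * ‖w‖ ≤ (1 / 2) * ‖w‖ := mul_le_mul_of_nonneg_right hεβ (norm_nonneg _)
    linarith
  have hsrc : ∀ v, ‖v + E (Ring.inverse (T - E) v)‖ ≤ 2 * ‖v‖ := fun v => by
    have hw := hn0 v
    calc ‖v + E (Ring.inverse (T - E) v)‖ ≤ ‖v‖ + ‖E (Ring.inverse (T - E) v)‖ := norm_add_le _ _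
      _ ≤ ‖v‖ + ε' * ‖Ring.inverse (T - E) v‖ := add_le_add_right (hEsup _) _
      _ ≤ ‖v‖ + ε' * (2 * β * ‖v‖) := add_le_add_right (mul_le_mul_of_nonneg_left hw hε') _
      _ = (1 + 2 * (ε' * β)) * ‖v‖ := by ring
      _ ≤ 2 * ‖v‖ := by
          refine mul_le_mul_of_nonneg_right ?_ (norm_nonneg _)
          linarith
  have hcomp : ∀ {W : Type} [SeminormedAddCommGroup W] (S : (FBondY i → 𝔸) → W) {β' : ℝ}, (∀ u, ‖S (G u)‖ ≤ β' * ‖u‖) → 0 ≤ β' →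
      ∀ v, ‖S (Ring.inverse (T - E) v)‖ ≤ 2 * β' * ‖v‖ := fun S β' hS hβ' v => by
    rw [hfp v]
    calc ‖S (G (v + E (Ring.inverse (T - E) v)))‖ ≤ β' * ‖v + E (Ring.inverse (T - E) v)‖ := hS _
      _ ≤ β' * (2 * ‖v‖) := mul_le_mul_of_nonneg_left (hsrc v) hβ'
      _ = 2 * β' * ‖v‖ := by ring
  refine ⟨hU, fun F => ?_, fun F ν => ?_, fun F => ?_⟩
  · -- n = 0
    have h := hn0 F
    rw [hN, hN]
    calc w₁ * ‖Ring.inverse (T - E) F‖ ≤ w₁ * (2 * (B₀ * w₃ / w₁) * ‖F‖) := mul_le_mul_of_nonneg_left h hw₁p.le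
      _ = 2 * B₀ * (w₃ * ‖F‖) := by field_simp
  · -- n = 1
    have hS : ∀ u, ‖cdB i U ν (G u)‖ ≤ (B₀ * w₃ / w₂) * ‖u‖ := fun u => by
      have h := hG1 u ν
      rw [hN, hN] at h
      have : w₂ * ‖cdB i U ν (G u)‖ ≤ B₀ * (w₃ * ‖u‖) := h
      rw [div_mul_eq_mul_div, le_div_iff₀ hw₂p]
      calc ‖cdB i U ν (G u)‖ * w₂ = w₂ * ‖cdB i U ν (G u)‖ := mul_comm _ _
        _ ≤ B₀ * (w₃ * ‖u‖) := this
        _ = B₀ * w₃ * ‖u‖ := by ring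
    have h := hcomp (fun Ψ => cdB i U ν Ψ) hS (by positivity) F
    rw [hN, hN]
    calc w₂ * ‖cdB i U ν (Ring.inverse (T - E) F)‖ ≤ w₂ * (2 * (B₀ * w₃ / w₂) * ‖F‖) := mul_le_mul_of_nonneg_left h hw₂p.le
      _ = 2 * B₀ * (w₃ * ‖F‖) := by field_simp
  · -- n = 3
    have hS : ∀ u, ‖lapB i U (G u)‖ ≤ (B₀ * w₃ / w₃) * ‖u‖ := fun u => by
      have h := hG3 u
      rw [hN, hN] at h
      have : w₃ * ‖lapB i U (G u)‖ ≤ B₀ * (w₃ * ‖u‖) := h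
      rw [div_mul_eq_mul_div, le_div_iff₀ hw₃p]
      calc ‖lapB i U (G u)‖ * w₃ = w₃ * ‖lapB i U (G u)‖ := mul_comm _ _
        _ ≤ B₀ * (w₃ * ‖u‖) := this
        _ = B₀ * w₃ * ‖u‖ := by ring
    have h := hcomp (fun Ψ => lapB i U Ψ) hS (by positivity) F
    rw [hN, hN]
    calc w₃ * ‖lapB i U (Ring.inverse (T - E) F)‖ ≤ w₃ * (2 * (B₀ * w₃ / w₃) * ‖F‖) := mul_le_mul_of_nonneg_left h hw₃p.le
      _ = 2 * B₀ * (w₃ * ‖F‖) := by field_simp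

end Members

end Literature.MathematicalPhysics.QuantumFieldTheory.Balaban1983to89.B9B8KnitNeumannCoreReal
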